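import Literature.AlgebraicGeometry.Morphisms.CechModuleRefinement
import Literature.AlgebraicGeometry.Morphisms.CechH1Pullback
import HarnessLib

/-!
# The Čech groups of `𝒪_X` and of push-forwards as Čech groups of sheaves of modules; `Ȟ⁰ = Γ`

Bridges between the module Čech groups of `Morphisms/CechModule` (`cechMH0`, `CechMH1` of a sheaf of
`𝒪_X`-modules `M : X.Modules`) and the structure-sheaf Čech groups of `Morphisms/CechH1` (`CechH1 f U`),
for a scheme `f : X → Spec A` and a family of opens `U`:

* `CechMH1_unit` — for `M = 𝒪_X` (Mathlib's `SheafOfModules.unit`), `Ȟ¹(𝒰, 𝒪_X)` of `CechModule` IS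
  `CechH1 f U` (definitionally; likewise the cochains, `cechMD0/1_unit`);
* `MSections.pushforwardEquiv`, `cechMH1PushforwardEquiv`, `cechMH0PushforwardEquiv` — for a morphism
  of `A`-schemes `π : Y → X` (`π ≫ f_X = f_Y`) and `N : Y.Modules`, the Čech groups of `π_* N` on `𝒰`
  are those of `N` on `π⁻¹𝒰`, `A`-linearly (The Stacks Project, Tag 01ED; the scalar actions agree by
  the naturality of `π`, `Sections.comap`); in particular **`Ȟ¹(𝒰, π_*𝒪_Y) ≅ Ȟ¹(π⁻¹𝒰, 𝒪_Y)` and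
  `Ȟ⁰(𝒰, π_*𝒪_Y) ≅ Ȟ⁰(π⁻¹𝒰, 𝒪_Y)`** (`moduleFinite_cechMH1_pushforward_unit_iff`);
* `cechMH0EquivSections` — **`Ȟ⁰(𝒰, M) ≅ Γ(X, M)` for a covering `𝒰` of `X`** (the sheaf axiom,
  Görtz–Wedhorn II, Lemma 21.65).

These identify the inputs `H⁰(X', 𝒪_{X'})`, `H¹(X, π_*𝒪_{X'})` of the Chow-lemma step of the finiteness
theorem (Görtz–Wedhorn II, Thm. 23.17) with the structure-sheaf statements of
`Morphisms/CechH0Projective`, `Morphisms/CechH1ProjectiveCover`. Everything is proved; no named facts.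
Mathlib searched (pin v4.32): `Scheme.Modules.pushforward_obj_obj` (definitional), `Scheme.Hom.app_eq_appLE`
(used).

## References

* The Stacks Project, Tag 01ED (Cohomology, Section 20.9: functoriality of the Čech complex).
  [StacksProject]
* U. Görtz, T. Wedhorn, *Algebraic Geometry II: Cohomology of Schemes* (2023),
  doi:10.1007/978-3-658-43031-3: Lemma 21.65, p. 259; Thm. 23.17, pp. 424–425. [GortzWedhorn2023]
-/

noncomputable section

open CategoryTheory AlgebraicGeometry Limits TopologicalSpace Opposite

universe u v

namespace Literature.AlgebraicGeometry.Morphisms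

variable {A : Type u} [CommRing A] {X : Scheme.{u}} (f : X ⟶ Spec (.of A)) {ι : Type v}
  (U : ι → X.Opens)

/-! ## The structure sheaf as a sheaf of modules -/

/-- The sections of `𝒪_X` as a sheaf of modules (Mathlib's `SheafOfModules.unit`) are the sections
of `𝒪_X`, with the same `A`-module structure: definitionally. [folklore] -/
theorem MSections_unit (V : X.Opens) :
    MSections f (SheafOfModules.unit X.ringCatSheaf) V = Sections f V := rfl

/-- `d⁰` of `𝒪_X` as a sheaf of modules is `cechD0`. [folklore] -/
theorem cechMD0_unit (b : CechC0 f U) :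
    cechMD0 f (SheafOfModules.unit X.ringCatSheaf) U b = cechD0 f U b := rfl

/-- `d¹` of `𝒪_X` as a sheaf of modules is `cechD1`. [folklore] -/
theorem cechMD1_unit (c : CechC1 f U) :
    cechMD1 f (SheafOfModules.unit X.ringCatSheaf) U c = cechD1 f U c := rfl

/-- **`Ȟ¹(𝒰, 𝒪_X)` of `CechModule` is `CechH1 f U`** (as `A`-modules, definitionally). [folklore] -/
theorem CechMH1_unit : CechMH1 f (SheafOfModules.unit X.ringCatSheaf) U = CechH1 f U := rfl

/-- `Ȟ⁰(𝒰, 𝒪_X)` of `CechModule` is `ker d⁰` of `Morphisms/CechH1`. [folklore] -/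
theorem cechMH0_unit :
    cechMH0 f (SheafOfModules.unit X.ringCatSheaf) U = LinearMap.ker (cechD0 f U) := rfl

/-- Finiteness of `Ȟ¹(𝒰, 𝒪_X)` in either language. [folklore] -/
theorem moduleFinite_cechMH1_unit_iff :
    Module.Finite A (CechMH1 f (SheafOfModules.unit X.ringCatSheaf) U) ↔
      Module.Finite A (CechH1 f U) := Iff.rfl

/-- Finiteness of `Ȟ⁰(𝒰, 𝒪_X)` in either language. [folklore] -/
theorem moduleFinite_cechMH0_unit_iff :
    Module.Finite A (cechMH0 f (SheafOfModules.unit X.ringCatSheaf) U) ↔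
      Module.Finite A (LinearMap.ker (cechD0 f U)) := Iff.rfl

/-! ## Push-forwards -/

section Pushforward

variable {Y : Scheme.{u}} (fY : Y ⟶ Spec (.of A)) (π : Y ⟶ X) (hπ : π ≫ f = fY) (N : Y.Modules)

include hπ in
/-- The scalar by which `a ∈ A` acts on `Γ(V, π_*N) = Γ(π⁻¹V, N)` through `X` is the one through `Y`.
[folklore] -/
theorem app_algebraMap_eq (V : X.Opens) (a : A) :
    (π.app V (algebraMap A (Sections f V) a) : Sections fY (π ⁻¹ᵁ V)) =
      algebraMap A (Sections fY (π ⁻¹ᵁ V)) a := by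
  have e := (Sections.comap f fY π hπ (le_refl (π ⁻¹ᵁ V))).commutes a
  rw [Sections.comap_apply] at e
  rw [← e]
  exact congrArg (fun φ => (φ : Γ(X, V) ⟶ Γ(Y, π ⁻¹ᵁ V)) (algebraMap A (Sections f V) a))
    (π.app_eq_appLE (U := V))

/-- Restriction maps of `π_*N` are those of `N` (Mathlib `Scheme.Modules.pushforward_obj_presheaf_map`,
definitional). [folklore] -/
theorem MSections.res_pushforward {V W : X.Opens} (h : W ≤ V)
    (m : MSections f ((Scheme.Modules.pushforward π).obj N) V) :
    (MSections.res f ((Scheme.Modules.pushforward π).obj N) h m : MSections fY N (π ⁻¹ᵁ W)) =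
      MSections.res fY N (π.preimage_mono h) (m : MSections fY N (π ⁻¹ᵁ V)) := rfl

include hπ in
/-- **`Γ(V, π_*N) = Γ(π⁻¹V, N)` as `A`-modules**: the identity map is `A`-linear from the module
structure through `X` to the one through `Y`. [cite: StacksProject, Tag 01ED (Cohomology, Section 20.9)] -/
def MSections.pushforwardEquiv (V : X.Opens) :
    MSections f ((Scheme.Modules.pushforward π).obj N) V ≃ₗ[A] MSections fY N (π ⁻¹ᵁ V) where
  toFun m := m
  invFun m := m
  map_add' _ _ := rfl
  map_smul' a m := by
    change @HSMul.hSMul (Sections fY (π ⁻¹ᵁ V)) (MSections fY N (π ⁻¹ᵁ V)) (MSections fY N (π ⁻¹ᵁ V))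
        instHSMul (π.app V (algebraMap A (Sections f V) a)) m =
      @HSMul.hSMul (Sections fY (π ⁻¹ᵁ V)) (MSections fY N (π ⁻¹ᵁ V)) (MSections fY N (π ⁻¹ᵁ V))
        instHSMul (algebraMap A (Sections fY (π ⁻¹ᵁ V)) a) m
    rw [app_algebraMap_eq f fY π hπ]
  left_inv _ := rfl
  right_inv _ := rfl

/-- `pushforwardEquiv` is the identity on elements. [folklore] -/
theorem MSections.pushforwardEquiv_apply (V : X.Opens)
    (m : MSections f ((Scheme.Modules.pushforward π).obj N) V) :
    MSections.pushforwardEquiv f fY π hπ N V m = (m : MSections fY N (π ⁻¹ᵁ V)) := rfl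

/-- The `0`-cochains of `π_*N` on `𝒰` are those of `N` on `π⁻¹𝒰`, `A`-linearly. [folklore] -/
def cechMC0PushforwardEquiv :
    CechMC0 f ((Scheme.Modules.pushforward π).obj N) U ≃ₗ[A] CechMC0 fY N (preimageFamily π U) :=
  LinearEquiv.piCongrRight fun i => MSections.pushforwardEquiv f fY π hπ N (U i)

/-- The `1`-cochains of `π_*N` on `𝒰` are those of `N` on `π⁻¹𝒰`, `A`-linearly. [folklore] -/
def cechMC1PushforwardEquiv :
    CechMC1 f ((Scheme.Modules.pushforward π).obj N) U ≃ₗ[A] CechMC1 fY N (preimageFamily π U) :=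
  LinearEquiv.piCongrRight fun i => LinearEquiv.piCongrRight fun j =>
    MSections.pushforwardEquiv f fY π hπ N (U i ⊓ U j)

/-- The `2`-cochains of `π_*N` on `𝒰` are those of `N` on `π⁻¹𝒰`, `A`-linearly. [folklore] -/
def cechMC2PushforwardEquiv :
    CechMC2 f ((Scheme.Modules.pushforward π).obj N) U ≃ₗ[A] CechMC2 fY N (preimageFamily π U) :=
  LinearEquiv.piCongrRight fun i => LinearEquiv.piCongrRight fun j => LinearEquiv.piCongrRight fun k =>
    MSections.pushforwardEquiv f fY π hπ N (U i ⊓ U j ⊓ U k)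

/-- The identifications commute with `d⁰`. [folklore] -/
theorem cechMD0_pushforwardEquiv (b : CechMC0 f ((Scheme.Modules.pushforward π).obj N) U) :
    cechMD0 fY N (preimageFamily π U) (cechMC0PushforwardEquiv f U fY π hπ N b) =
      cechMC1PushforwardEquiv f U fY π hπ N (cechMD0 f _ U b) := by
  funext i j
  rfl

/-- The identifications commute with `d¹`. [folklore] -/
theorem cechMD1_pushforwardEquiv (c : CechMC1 f ((Scheme.Modules.pushforward π).obj N) U) :
    cechMD1 fY N (preimageFamily π U) (cechMC1PushforwardEquiv f U fY π hπ N c) =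
      cechMC2PushforwardEquiv f U fY π hπ N (cechMD1 f _ U c) := by
  funext i j k
  rfl

/-- Cocycles correspond. [folklore] -/
theorem mem_cechMZ1_pushforwardEquiv_iff (c : CechMC1 f ((Scheme.Modules.pushforward π).obj N) U) :
    cechMC1PushforwardEquiv f U fY π hπ N c ∈ cechMZ1 fY N (preimageFamily π U) ↔
      c ∈ cechMZ1 f _ U := by
  rw [mem_cechMZ1_iff, mem_cechMZ1_iff, cechMD1_pushforwardEquiv, LinearEquiv.map_eq_zero_iff]

/-- Coboundaries correspond. [folklore] -/
theorem mem_cechMB1_pushforwardEquiv_iff (c : CechMC1 f ((Scheme.Modules.pushforward π).obj N) U) :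
    cechMC1PushforwardEquiv f U fY π hπ N c ∈ cechMB1 fY N (preimageFamily π U) ↔
      c ∈ cechMB1 f _ U := by
  rw [mem_cechMB1_iff, mem_cechMB1_iff]
  constructor
  · rintro ⟨b, hb⟩
    refine ⟨(cechMC0PushforwardEquiv f U fY π hπ N).symm b, ?_⟩
    apply (cechMC1PushforwardEquiv f U fY π hπ N).injective
    rw [← cechMD0_pushforwardEquiv, LinearEquiv.apply_symm_apply, hb]
  · rintro ⟨b, rfl⟩
    exact ⟨cechMC0PushforwardEquiv f U fY π hπ N b, cechMD0_pushforwardEquiv f U fY π hπ N b⟩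

/-- Cocycles correspond, as an `A`-linear equivalence. [folklore] -/
def cechMZ1PushforwardEquiv :
    ↥(cechMZ1 f ((Scheme.Modules.pushforward π).obj N) U) ≃ₗ[A] ↥(cechMZ1 fY N (preimageFamily π U)) :=
  (cechMC1PushforwardEquiv f U fY π hπ N).ofSubmodules _ _ (by
    ext c
    rw [Submodule.mem_map]
    constructor
    · rintro ⟨c', hc', rfl⟩
      exact (mem_cechMZ1_pushforwardEquiv_iff f U fY π hπ N c').mpr hc'
    · intro hc
      refine ⟨(cechMC1PushforwardEquiv f U fY π hπ N).symm c, ?_, LinearEquiv.apply_symm_apply _ _⟩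
      rw [← mem_cechMZ1_pushforwardEquiv_iff f U fY π hπ N, LinearEquiv.apply_symm_apply]
      exact hc)

/-- **`Ȟ¹(𝒰, π_*N) ≅ Ȟ¹(π⁻¹𝒰, N)` `A`-linearly** (the same cochains and differentials; the `A`-actions
agree by `app_algebraMap_eq`). [cite: StacksProject, Tag 01ED (Cohomology, Section 20.9)] -/
def cechMH1PushforwardEquiv :
    CechMH1 f ((Scheme.Modules.pushforward π).obj N) U ≃ₗ[A] CechMH1 fY N (preimageFamily π U) :=
  Submodule.Quotient.equiv _ _ (cechMZ1PushforwardEquiv f U fY π hπ N) (by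
    ext z
    rw [Submodule.mem_map, Submodule.mem_comap]
    constructor
    · rintro ⟨z', hz', rfl⟩
      rw [Submodule.mem_comap] at hz'
      exact (mem_cechMB1_pushforwardEquiv_iff f U fY π hπ N _).mpr hz'
    · intro hz
      refine ⟨(cechMZ1PushforwardEquiv f U fY π hπ N).symm z, ?_, LinearEquiv.apply_symm_apply _ _⟩
      rw [Submodule.mem_comap, ← mem_cechMB1_pushforwardEquiv_iff f U fY π hπ N]
      have : (cechMC1PushforwardEquiv f U fY π hπ N) ((cechMZ1PushforwardEquiv f U fY π hπ N).symm z :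
          CechMC1 f _ U) = (z : CechMC1 fY N (preimageFamily π U)) := by
        change ((cechMZ1PushforwardEquiv f U fY π hπ N) ((cechMZ1PushforwardEquiv f U fY π hπ N).symm z) :
          CechMC1 fY N (preimageFamily π U)) = z
        rw [LinearEquiv.apply_symm_apply]
      rw [Submodule.subtype_apply, this]
      exact hz)

/-- **`Ȟ⁰(𝒰, π_*N) ≅ Ȟ⁰(π⁻¹𝒰, N)` `A`-linearly.** [cite: StacksProject, Tag 01ED (Cohomology, Section 20.9)] -/
def cechMH0PushforwardEquiv :
    ↥(cechMH0 f ((Scheme.Modules.pushforward π).obj N) U) ≃ₗ[A] ↥(cechMH0 fY N (preimageFamily π U)) :=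
  (cechMC0PushforwardEquiv f U fY π hπ N).ofSubmodules _ _ (by
    ext b
    constructor
    · rintro ⟨b', hb', rfl⟩
      have hb'' : cechMD0 f _ U b' = 0 := hb'
      change cechMD0 fY N (preimageFamily π U) (cechMC0PushforwardEquiv f U fY π hπ N b') = 0
      rw [cechMD0_pushforwardEquiv, hb'', map_zero]
    · intro hb
      have hb' : cechMD0 fY N (preimageFamily π U) b = 0 := hb
      refine ⟨(cechMC0PushforwardEquiv f U fY π hπ N).symm b, ?_, LinearEquiv.apply_symm_apply _ _⟩
      change cechMD0 f _ U ((cechMC0PushforwardEquiv f U fY π hπ N).symm b) = 0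
      apply (cechMC1PushforwardEquiv f U fY π hπ N).injective
      rw [← cechMD0_pushforwardEquiv, LinearEquiv.apply_symm_apply, hb', map_zero])

include hπ in
/-- Finiteness of `Ȟ¹(𝒰, π_*𝒪_Y)` is finiteness of `Ȟ¹(π⁻¹𝒰, 𝒪_Y) = CechH1 f_Y (π⁻¹𝒰)`. [folklore] -/
theorem moduleFinite_cechMH1_pushforward_unit_iff :
    Module.Finite A (CechMH1 f ((Scheme.Modules.pushforward π).obj (SheafOfModules.unit Y.ringCatSheaf)) U) ↔
      Module.Finite A (CechH1 fY (preimageFamily π U)) :=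
  ⟨fun _ => (moduleFinite_cechMH1_unit_iff fY (preimageFamily π U)).mp
      (Module.Finite.equiv (cechMH1PushforwardEquiv f U fY π hπ (SheafOfModules.unit Y.ringCatSheaf))),
    fun h =>
      haveI := (moduleFinite_cechMH1_unit_iff fY (preimageFamily π U)).mpr h
      Module.Finite.equiv (cechMH1PushforwardEquiv f U fY π hπ (SheafOfModules.unit Y.ringCatSheaf)).symm⟩

include hπ in
/-- Finiteness of `Ȟ⁰(𝒰, π_*𝒪_Y)` is finiteness of `Ȟ⁰(π⁻¹𝒰, 𝒪_Y)`. [folklore] -/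
theorem moduleFinite_cechMH0_pushforward_unit_iff :
    Module.Finite A (cechMH0 f ((Scheme.Modules.pushforward π).obj (SheafOfModules.unit Y.ringCatSheaf)) U) ↔
      Module.Finite A (LinearMap.ker (cechD0 fY (preimageFamily π U))) :=
  ⟨fun _ => (moduleFinite_cechMH0_unit_iff fY (preimageFamily π U)).mp
      (Module.Finite.equiv (cechMH0PushforwardEquiv f U fY π hπ (SheafOfModules.unit Y.ringCatSheaf))),
    fun h =>
      haveI := (moduleFinite_cechMH0_unit_iff fY (preimageFamily π U)).mpr h
      Module.Finite.equiv (cechMH0PushforwardEquiv f U fY π hπ (SheafOfModules.unit Y.ringCatSheaf)).symm⟩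

end Pushforward

/-! ## `Ȟ⁰(𝒰, M) = Γ(X, M)` for a covering -/

/-- **`Ȟ⁰(𝒰, M) ≅ Γ(X, M)` for a covering `𝒰` of `X`**: a family of sections agreeing on overlaps glues
uniquely (the sheaf axiom; Görtz–Wedhorn II, Lemma 21.65: "the natural map `Γ(U, 𝓕) → Ȟ⁰(𝓤, 𝓕)` is an
isomorphism"). [cite: GortzWedhorn2023, Lemma 21.65 (p. 259)] -/
def cechMH0EquivSections (M : X.Modules) (hU : ⨆ i, U i = ⊤) :
    MSections f M ⊤ ≃ₗ[A] ↥(cechMH0 f M U) := by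
  refine LinearEquiv.ofBijective
    (LinearMap.codRestrict _ (LinearMap.pi fun i => MSections.res f M (le_top : U i ≤ ⊤)) fun s => ?_)
    ⟨?_, ?_⟩
  · rw [mem_cechMH0_iff]
    intro i j
    rw [LinearMap.pi_apply, LinearMap.pi_apply, MSections.res_res, MSections.res_res]
  · intro s t hst
    apply MSections.eq_of_res_eq f M U (fun i => le_top) (by rw [hU])
    intro i
    exact congrFun (congrArg Subtype.val hst) i
  · intro b
    obtain ⟨t, ht⟩ := MSections.exists_res_eq f M U (fun i => le_top) (by rw [hU]) (b : CechMC0 f M U)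
      fun i j => ((mem_cechMH0_iff f M U _).mp b.2 i j).symm
    exact ⟨t, Subtype.ext (funext ht)⟩

/-- Hence `Ȟ⁰(𝒰, M)` is finite iff `Γ(X, M)` is. [folklore] -/
theorem moduleFinite_cechMH0_iff (M : X.Modules) (hU : ⨆ i, U i = ⊤) :
    Module.Finite A (cechMH0 f M U) ↔ Module.Finite A (MSections f M ⊤) :=
  ⟨fun _ => Module.Finite.equiv (cechMH0EquivSections f U M hU).symm,
    fun _ => Module.Finite.equiv (cechMH0EquivSections f U M hU)⟩

end Literature.AlgebraicGeometry.Morphisms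

end
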